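import Mathlib
import HarnessLib

/-!
# OutsiderSandwich — a toric diagonal is the UNIQUE perfect matching of its vertex set
(decomp-mm lens 4, gen 43, kernel K43-5; THESES-FREE, `ω`-free; helper toward `LaserTangency`,
stmt-32268 — the criterion behind the `N = 3` toric census of `kroneckerPow (cwTensor ℂ 2) 3`)

WHAT.  Let `Φ ⊆ I × J × L` be a support and `Ψ ⊆ Φ` a diagonal (leg-injective) COMBINATORIAL
DEGENERATION in the sense of Strassen / Bürgisser–Clausen–Shokrollahi (15.29): weights `a, b, c` with
`a i + b j + c l = 0` on `Ψ` and `≥ 1` on `Φ ∖ Ψ`.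

* `subset_of_sum_eq`: any `P ⊆ Φ` with `Σ_P (a+b+c) = Σ_Ψ (a+b+c)` lies inside `Ψ`;
* `sum_eq_of_image_eq`: two leg-injective sets with the same three leg images have the same
  weight sum;
* `matching_eq`: hence a leg-injective `P ⊆ Φ` with the same leg images as `Ψ` EQUALS `Ψ` — a toric
  diagonal is the unique perfect 3-dimensional matching of its own vertex sets inside `Φ`;
* `no_comb_degeneration_of_two_matchings`: so if the vertex sets `(U, V, W)` carry two distinct
  perfect matchings inside `Φ`, no diagonal combinatorial degeneration of `Φ` has leg images
  `(U, V, W)`.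

USE (data, not formalised): combined with the value counts of `…ToricCeilingPow.count_identity`
(which restrict the possible complements of `U, V, W`), an exhaustive enumeration of complements for
the product frames of `cw₂^{⊠3}` finds two perfect matchings in every admissible case of sizes `25`
and `24` (all four product-basis types) and of size `23` in the types with `≥ 2` permutation
coordinates: the toric value of `cw₂^{⊠3}` is `≤ 23` in every product basis and `≤ 22` in those; the
tree has `21` in the cw basis (K42-h).  See the lens-4 NODE-g43 memo for the census and engines.
Weights live in any linearly ordered commutative ring.
-/

set_option linter.dupNamespace false

namespace Summit.MatrixMultiplication.MatrixMultiplication.Theorems.OutsiderSandwichToricUniqueness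

open Finset

variable {R : Type*} [CommRing R]
variable {I J L : Type*} [DecidableEq I] [DecidableEq J] [DecidableEq L]

/-- If `Ψ ⊆ Φ` is a combinatorial degeneration (weights `0` on `Ψ`, `≥ 1` on `Φ ∖ Ψ`) then every
`P ⊆ Φ` with the same total weight as `Ψ` lies inside `Ψ`. [new] -/
theorem subset_of_sum_eq [LinearOrder R] [IsStrictOrderedRing R] {Φ Ψ P : Finset (I × J × L)}
    {a : I → R} {b : J → R} {c : L → R}
    (hzero : ∀ t ∈ Ψ, a t.1 + b t.2.1 + c t.2.2 = 0)
    (hone : ∀ t ∈ Φ, t ∉ Ψ → 1 ≤ a t.1 + b t.2.1 + c t.2.2) (hPΦ : P ⊆ Φ)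
    (hsum : ∑ t ∈ P, (a t.1 + b t.2.1 + c t.2.2) = ∑ t ∈ Ψ, (a t.1 + b t.2.1 + c t.2.2)) :
    P ⊆ Ψ := by
  have hΨ0 : ∑ t ∈ Ψ, (a t.1 + b t.2.1 + c t.2.2) = 0 := Finset.sum_eq_zero hzero
  have hnonneg : ∀ t ∈ P, 0 ≤ a t.1 + b t.2.1 + c t.2.2 := by
    intro t ht
    by_cases htΨ : t ∈ Ψ
    · rw [hzero t htΨ]
    · exact le_trans zero_le_one (hone t (hPΦ ht) htΨ)
  have hall := (Finset.sum_eq_zero_iff_of_nonneg hnonneg).1 (hsum.trans hΨ0)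
  intro t ht
  by_contra htΨ
  have h1 := hone t (hPΦ ht) htΨ
  rw [hall t ht] at h1
  exact absurd h1 (not_le.mpr zero_lt_one)

/-- Two leg-injective sets with the same three leg images have the same total weight. [new] -/
theorem sum_eq_of_image_eq {Ψ P : Finset (I × J × L)} (a : I → R) (b : J → R) (c : L → R)
    (jP₁ : Set.InjOn (fun t : I × J × L => t.1) P) (jP₂ : Set.InjOn (fun t : I × J × L => t.2.1) P)
    (jP₃ : Set.InjOn (fun t : I × J × L => t.2.2) P)
    (jΨ₁ : Set.InjOn (fun t : I × J × L => t.1) Ψ) (jΨ₂ : Set.InjOn (fun t : I × J × L => t.2.1) Ψ)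
    (jΨ₃ : Set.InjOn (fun t : I × J × L => t.2.2) Ψ)
    (i₁ : P.image (fun t => t.1) = Ψ.image (fun t => t.1))
    (i₂ : P.image (fun t => t.2.1) = Ψ.image (fun t => t.2.1))
    (i₃ : P.image (fun t => t.2.2) = Ψ.image (fun t => t.2.2)) :
    ∑ t ∈ P, (a t.1 + b t.2.1 + c t.2.2) = ∑ t ∈ Ψ, (a t.1 + b t.2.1 + c t.2.2) := by
  have e₁ : ∑ t ∈ P, a t.1 = ∑ t ∈ Ψ, a t.1 := by
    rw [← Finset.sum_image (f := a) jP₁, ← Finset.sum_image (f := a) jΨ₁, i₁]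
  have e₂ : ∑ t ∈ P, b t.2.1 = ∑ t ∈ Ψ, b t.2.1 := by
    rw [← Finset.sum_image (f := b) jP₂, ← Finset.sum_image (f := b) jΨ₂, i₂]
  have e₃ : ∑ t ∈ P, c t.2.2 = ∑ t ∈ Ψ, c t.2.2 := by
    rw [← Finset.sum_image (f := c) jP₃, ← Finset.sum_image (f := c) jΨ₃, i₃]
  simp only [Finset.sum_add_distrib, e₁, e₂, e₃]

/-- **Uniqueness of the toric diagonal.**  If `Ψ ⊆ Φ` is a diagonal combinatorial degeneration of
`Φ` and `P ⊆ Φ` is any perfect matching of the same vertex sets (leg-injective with the same three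
leg images), then `P = Ψ`. [new] -/
theorem matching_eq [LinearOrder R] [IsStrictOrderedRing R] {Φ Ψ P : Finset (I × J × L)}
    {a : I → R} {b : J → R} {c : L → R}
    (hzero : ∀ t ∈ Ψ, a t.1 + b t.2.1 + c t.2.2 = 0)
    (hone : ∀ t ∈ Φ, t ∉ Ψ → 1 ≤ a t.1 + b t.2.1 + c t.2.2) (hPΦ : P ⊆ Φ)
    (jP₁ : Set.InjOn (fun t : I × J × L => t.1) P) (jP₂ : Set.InjOn (fun t : I × J × L => t.2.1) P)
    (jP₃ : Set.InjOn (fun t : I × J × L => t.2.2) P)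
    (jΨ₁ : Set.InjOn (fun t : I × J × L => t.1) Ψ) (jΨ₂ : Set.InjOn (fun t : I × J × L => t.2.1) Ψ)
    (jΨ₃ : Set.InjOn (fun t : I × J × L => t.2.2) Ψ)
    (i₁ : P.image (fun t => t.1) = Ψ.image (fun t => t.1))
    (i₂ : P.image (fun t => t.2.1) = Ψ.image (fun t => t.2.1))
    (i₃ : P.image (fun t => t.2.2) = Ψ.image (fun t => t.2.2)) : P = Ψ := by
  have hsub : P ⊆ Ψ :=
    subset_of_sum_eq hzero hone hPΦ (sum_eq_of_image_eq a b c jP₁ jP₂ jP₃ jΨ₁ jΨ₂ jΨ₃ i₁ i₂ i₃)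
  refine Finset.eq_of_subset_of_card_le hsub ?_
  rw [← Finset.card_image_of_injOn jΨ₁, ← i₁, Finset.card_image_of_injOn jP₁]

/-- **Two perfect matchings kill every toric diagonal on the same vertex sets.**  If `P₁ ≠ P₂` are
leg-injective subsets of `Φ` with the same three leg images, then no diagonal combinatorial
degeneration `Ψ` of `Φ` (weights in `R`) has these leg images. [new] -/
theorem no_comb_degeneration_of_two_matchings [LinearOrder R] [IsStrictOrderedRing R]
    {Φ P₁ P₂ : Finset (I × J × L)} (hne : P₁ ≠ P₂)
    (h₁Φ : P₁ ⊆ Φ) (h₂Φ : P₂ ⊆ Φ)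
    (j₁₁ : Set.InjOn (fun t : I × J × L => t.1) P₁) (j₁₂ : Set.InjOn (fun t : I × J × L => t.2.1) P₁)
    (j₁₃ : Set.InjOn (fun t : I × J × L => t.2.2) P₁)
    (j₂₁ : Set.InjOn (fun t : I × J × L => t.1) P₂) (j₂₂ : Set.InjOn (fun t : I × J × L => t.2.1) P₂)
    (j₂₃ : Set.InjOn (fun t : I × J × L => t.2.2) P₂)
    (e₁ : P₁.image (fun t => t.1) = P₂.image (fun t => t.1))
    (e₂ : P₁.image (fun t => t.2.1) = P₂.image (fun t => t.2.1))
    (e₃ : P₁.image (fun t => t.2.2) = P₂.image (fun t => t.2.2)) :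
    ¬ ∃ (Ψ : Finset (I × J × L)) (a : I → R) (b : J → R) (c : L → R),
      (∀ t ∈ Ψ, a t.1 + b t.2.1 + c t.2.2 = 0) ∧ (∀ t ∈ Φ, t ∉ Ψ → 1 ≤ a t.1 + b t.2.1 + c t.2.2) ∧
      Set.InjOn (fun t : I × J × L => t.1) Ψ ∧ Set.InjOn (fun t : I × J × L => t.2.1) Ψ ∧
      Set.InjOn (fun t : I × J × L => t.2.2) Ψ ∧
      Ψ.image (fun t => t.1) = P₁.image (fun t => t.1) ∧
      Ψ.image (fun t => t.2.1) = P₁.image (fun t => t.2.1) ∧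
      Ψ.image (fun t => t.2.2) = P₁.image (fun t => t.2.2) := by
  rintro ⟨Ψ, a, b, c, hzero, hone, jΨ₁, jΨ₂, jΨ₃, i₁, i₂, i₃⟩
  have hP₁ : P₁ = Ψ :=
    matching_eq hzero hone h₁Φ j₁₁ j₁₂ j₁₃ jΨ₁ jΨ₂ jΨ₃ i₁.symm i₂.symm i₃.symm
  have hP₂ : P₂ = Ψ :=
    matching_eq hzero hone h₂Φ j₂₁ j₂₂ j₂₃ jΨ₁ jΨ₂ jΨ₃ (e₁ ▸ i₁).symm (e₂ ▸ i₂).symm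
      (e₃ ▸ i₃).symm
  exact hne (hP₁.trans hP₂.symm)

end Summit.MatrixMultiplication.MatrixMultiplication.Theorems.OutsiderSandwichToricUniqueness
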